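import Summits.CriticalPhenomena.SAWScalingLimit.Theses.SAWLaplacianWalk
import Literature.Probability.RandomPlanarGeometry.SLELawOfDrivingProcessLocal
import Literature.Probability.RandomPlanarGeometry.DrivingFunctionMeasurable
import Literature.Probability.RandomPlanarGeometry.SpinObservableLocalMartingale

/-!
# Birth skeleton (`Lines/birth.lean`) for crux `HarmonicIdentification` (stmt-CriticalPhenomena-4483)

Route `SAWLaplacianWalk` of `CriticalPhenomena/SAWScalingLimit`, crux r5 (L): let `φ` be a chordal
uniformizing map of `(D; a, b)`, `ν` a probability law on curve classes, `ν`-a.e. Loewner-describable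
through `φ` and starting at `a`; if for an unbounded (above or below) set `T` of reals `x` the stopped
harmonic 5/8-observables `N^{x,m}` of `W = drivingFunction φ` satisfy the cylinder identity for all
`m`, `s ≤ t`, `ψ`, then `ν` is the chordal SLE_{8/3} law (`IsSLELaw (8/3) D ν`).

## The line — the crux docstring's own proof route, typed on the tree's moment-free CDHKS pipeline

"monotone class ⇒ `N^{x,m}` bounded martingales; far-field stopping of `W`;
`x^{5/4} N^x_t = 1 + (5/4) W_t/x + (45/32)(W_t² − (8/3)t)/x² + O(x⁻³)` ⇒ `W` and `W² − (8/3)t`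
continuous local martingales ⇒ Lévy ⇒ `isSLELaw_of_isLocalMartingale_driving`", cut exactly as the
tree cuts the spin-Ising (`κ = 3`) instance
(`Literature/Probability/RandomPlanarGeometry/SpinObservableLocalMartingale.lean`:
`martingale_re_im_spinObservableProcess_of_cylinder` → `martingale_stoppedDriver_of_spinObservable` /
`martingale_stoppedQuad_of_spinObservable` → `isLocalMartingale_hasQuadraticVariation_of_spinObservable`
→ `isSLELaw_of_isLocalMartingale_driving_of_lt_four`), with the harmonic (restriction /
change-of-target) observable `N^x_t = [g_t′(x)/(g_t(x) − W_t)²]^{5/8}` of a REAL point `x` in place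
of the fermion at `iy`:

* § 1 vocabulary (verbatim the `let`s of the crux, on a general probability space): `harmonicGap`,
  `harmonicObservable`, `harmonicLevelTime`, the stopped process `harmonicProcess W x m` and the
  monotone-class form `HarmonicCylinderIdentity P W T` of "every `N^{x,m}` is a martingale in the
  filtration generated by `W`".
* `stub_harmonicNaturalMartingales : HarmonicNaturalMartingales` (M/L) — ADAPTEDNESS + MONOTONE
  CLASS: for `W` with strongly measurable coordinates, continuous paths, `W₀ = 0`, the cylinder
  identities make every `N^{x,m}` (`x ∈ T`, `m ∈ ℕ`) a martingale in the natural filtration of `W`.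
  Content: the stopped harmonic observable is a bounded (`≤ max((m+1)^{5/4}, |x|^{-5/4})`: the level
  `|g − W| ≤ 1/(m+1)` is hit strictly before the swallowing time, so the junk branch of `Loewner.map`
  is never read — refuter rreview note of 2026-08-15) and `𝓕^W_t`-measurable functional of the path
  (tree: `Loewner.measurable_realFlowTrunc`, `measurableSet_lt_swallowingTime`, LoewnerAdapted.lean),
  then `Process.martingale_natural_of_integral_cylinder`. This stub is where the crux's typed
  "why it might fail" (Bochner junk value if `c ↦ N^{x,m}_t(c)` were not measurable/integrable) is met.
* `stub_harmonicStoppedDriver : HarmonicStoppedDriver` (L) — FAR FIELD, ORDER `x⁻¹`: on any probability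
  space, `W` strongly adapted with continuous paths and `W₀ = 0`, all `N^{x,m}` (`x ∈ T` unbounded
  above or below, all `m`) martingales ⇒ for every level `L > 0` the driver stopped at the tree's
  far-field stopping time `ρ_L = Loewner.farStopTime W L` is a martingale (coefficient `2b = 5/4` of
  `W_t/x`; one-sided `|x| → ∞` along `T` suffices since only `|x|` enters the remainder
  `O((L/128 + √t)³/|x|³)`; optional stopping at `ρ_L ∧ τ^{x,m}` with `m + 1 ≥ (L/128)²` so that the
  level time does not bite before `ρ_L`).
* `stub_harmonicStoppedQuad : HarmonicStoppedQuad` (L, HARDEST — carries the number) — FAR FIELD, ORDER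
  `x⁻²`: same hypotheses ⇒ `(W^{ρ_L})² − (8/3)(· ∧ ρ_L)` is a martingale: the coefficient
  `b(2b+1)(W² − 6t/(2b+1)) = (45/32)(W² − (8/3)t)` at `b = 5/8` is where `κ = 6/(2b+1) = 8/3` comes
  from (Lawler's Laplacian-`b` far field; LSW 2003 restriction exponent).
* `HarmonicIdentification_of` (kernel-checked, no `sorry`): recentring `W′ = W − W₀` of the Loewner
  transform (`= W` a.e. by `ae_drivingFunction_apply_zero`, the observables read the path only:
  `harmonicProcess_congr`), the crux hypothesis IS `HarmonicCylinderIdentity ν W T` (definitional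
  unfolding of its `let`s), stub A ⇒ natural martingales, stubs B/C ⇒ the two stopped martingales at
  every level, LOCALISATION along `ρ_{n+1}` (tree: `Loewner.isLocalizingSequence_farStopTime`,
  `Loewner.indicator_bot_lt_farStopTime`) ⇒ `W′/√(8/3)` is a continuous local martingale with
  `⟨·⟩_t = t`, and the tree's PROVED `isSLELaw_of_isLocalMartingale_driving_of_lt_four` at
  `κ = 8/3 < 4` (Lévy, SLE trace and transience are theorems of the tree) with `Loewner.IsDrivenBy`
  from `isLoewnerDescribed_drivingFunction` — concluding the crux BY NAME.

## Disproof / negatives used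
* `Cruxes/HarmonicIdentification/`: no workfiles at registration (`ledger crux ls
  stmt-CriticalPhenomena-4483`, 2026-08-17): no `Disproof.lean`, no `_false_without_` obstruction to
  honour, no landed `Negative/` lemma.
* `ledger negatives --problem CriticalPhenomena`: no entry concerns driving processes / martingale
  identification; the SAW entries (all-`δ` tightness stmt-0772, hex observables) are untouched — no
  stub asserts tightness or a lattice observable value; every stub is a statement of stochastic
  calculus / measure theory on a general probability space.
* Grounder note (g18-37, 2026-08-15): "provable with work (L): monotone class, far-field stopping,
  `W₀ = 0` from source = a; engine `isSLELaw_of_isLocalMartingale_driving_of_lt_four` in tree" — the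
  three stubs are exactly these three pieces of work; `W₀ = 0` a.e. is DISCHARGED in the composition
  (`ae_drivingFunction_apply_zero`), not stubbed.
* BC3 certificate (planner-skel-stmt-CriticalPhenomena-4483-0, 2026-08-17; probe files
  `bc/<Stub>_probe_{crux,summit}.lean` = this file's §§ 1–2 + `example : <Stub> → HarmonicIdentification`
  resp. `example : <Stub> → _root_.SAWScalingLimit`, each
  `by first | exact? | simpa [<Stub>] | (unfold <Stub>; simpa) | aesop` under `maxHeartbeats 400000`):
  all SIX probes FAIL — `lean check` rc 1, "unsolved goals `a : <Stub> ⊢ Theses.SAWLaplacianWalk.HarmonicIdentification`"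
  / "`⊢ SAWScalingLimit`", "aesop: failed to prove the goal after exhaustive search" — for
  `HarmonicNaturalMartingales` (36.6 s / 26.0 s), `HarmonicStoppedDriver` (44.4 s / 31.1 s),
  `HarmonicStoppedQuad` (50.2 s / 29.6 s): no stub is cheaply the crux or the summit. `lean check --json
  birth.lean`: rc 0, errors [], sorries 3 = the three `stub_*` (zero elsewhere); `#h21_check_skeleton
  "stmt-CriticalPhenomena-4483" …HarmonicIdentification stub_harmonicNaturalMartingales
  stub_harmonicStoppedDriver stub_harmonicStoppedQuad`: ok = true, codes [], theorem =
  `HarmonicIdentification_of`, stubs 3/3 resolved to the sorried theorems.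
* Vacuity pass: `HarmonicCylinderIdentity` is hypothesis-side in stub A (with the measurability
  burden ON the stub's conclusion `Martingale`, which includes integrability) and never conclusion-side;
  stubs B/C take genuine `Martingale` hypotheses (no Bochner junk); all three quantify over all
  probability spaces in `Type` (the composition instantiates `Ω = CurveClass ℂ`).
-/

noncomputable section

open MeasureTheory Filter Topology Set
open scoped NNReal
open UpperHalfPlane (upperHalfPlaneSet)
open Literature.Probability.RandomPlanarGeometry Literature.Probability.Process

namespace Summit.CriticalPhenomena.SAWScalingLimit.Cruxes.HarmonicIdentification.Birth

/-! ### 1. Vocabulary: the harmonic 5/8-observable of a real point and its stopped process -/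

/-- The gap `g_t(x) − w_t` of the real point `x` under the chordal Loewner chain of the PATH `w`
(verbatim the crux's `gap`; `Loewner.map` is defined on all of `ℂ`, junk value `x` after the
swallowing time `T_x`, a branch never read before the level times below). -/
def harmonicGap (w : ℝ≥0 → ℝ) (x : ℝ) (t : ℝ≥0) : ℝ :=
  (Loewner.map w t (x : ℂ)).re - w t

/-- The harmonic `5/8`-observable `N^x_t = [g_t′(x)/(g_t(x) − w_t)²]^{5/8}` in integrated form,
`g_t′(x) = exp(−2∫₀ᵗ ds/(g_s(x) − w_s)²)` (verbatim the crux's `N`). -/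
def harmonicObservable (w : ℝ≥0 → ℝ) (x : ℝ) (t : ℝ≥0) : ℝ :=
  Real.exp (-(5 / 4 : ℝ) * ∫ s in (0 : ℝ)..(t : ℝ), 1 / (harmonicGap w x s.toNNReal) ^ 2) *
    |harmonicGap w x t| ^ (-(5 / 4 : ℝ))

/-- The level time `τ^{x,m}`: the first time `|g_t(x) − w_t| ≤ 1/(m+1)`, capped at `m + 1`
(verbatim the crux's `τ`). -/
def harmonicLevelTime (w : ℝ≥0 → ℝ) (x : ℝ) (m : ℕ) : ℝ≥0 :=
  sInf ({t : ℝ≥0 | |harmonicGap w x t| ≤ 1 / ((m : ℝ) + 1)} ∪ {(m : ℝ≥0) + 1})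

/-- **The stopped harmonic observable process** `N^{x,m}_t = N^x_{t ∧ τ^{x,m}}` of a real process
`W : ℝ≥0 → Ω → ℝ` (it reads the path `u ↦ W u ω` only). -/
def harmonicProcess {Ω : Type*} (W : ℝ≥0 → Ω → ℝ) (x : ℝ) (m : ℕ) : ℝ≥0 → Ω → ℝ :=
  fun t ω ↦ harmonicObservable (fun u ↦ W u ω) x
    (min t (harmonicLevelTime (fun u ↦ W u ω) x m))

/-- **The harmonic cylinder identities** of a real process `W` on `(Ω, P)` along the set `T` of
marked points: for `x ∈ T`, `m ∈ ℕ`, `s ≤ t`, earlier times `S_k ≤ s` and continuous `|ψ| ≤ 1`,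
`∫ (N^{x,m}_t − N^{x,m}_s) ψ(W_{S₀}, …, W_{S_{n−1}}) dP = 0` (verbatim the crux's hypothesis). -/
def HarmonicCylinderIdentity {Ω : Type*} [MeasurableSpace Ω] (P : Measure Ω)
    (W : ℝ≥0 → Ω → ℝ) (T : Set ℝ) : Prop :=
  ∀ x ∈ T, ∀ (m : ℕ) (s t : ℝ≥0), s ≤ t → ∀ (n : ℕ) (S : Fin n → ℝ≥0), (∀ k, S k ≤ s) →
    ∀ ψ : (Fin n → ℝ) → ℝ, Continuous ψ → (∀ v, |ψ v| ≤ 1) →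
      ∫ ω, (harmonicProcess W x m t ω - harmonicProcess W x m s ω) * ψ (fun k ↦ W (S k) ω) ∂P = 0

/-! ### 2. The three stub statements -/

/-- STUB A statement — **natural-filtration martingales (adaptedness + monotone class).** On any
probability space, for a real process `W` with strongly measurable coordinates, continuous paths and
`W₀ = 0`, the harmonic cylinder identities along `T` make every stopped harmonic observable
`N^{x,m}` (`x ∈ T`, `m ∈ ℕ`) a martingale (adapted AND integrable) in the natural filtration of `W`. -/
def HarmonicNaturalMartingales : Prop :=
  ∀ {Ω : Type} [MeasurableSpace Ω] (P : Measure Ω) [IsProbabilityMeasure P] (W : ℝ≥0 → Ω → ℝ)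
    (hW : ∀ t, StronglyMeasurable (W t)), (∀ ω, Continuous (W · ω)) → (∀ ω, W 0 ω = 0) →
    ∀ T : Set ℝ, HarmonicCylinderIdentity P W T →
      ∀ x ∈ T, ∀ m : ℕ, Martingale (harmonicProcess W x m) (Filtration.natural W hW) P

/-- STUB B statement — **far field, order `x⁻¹`: the driver stopped at `ρ_L` is a martingale.** On
any probability space, `W` strongly adapted to `𝓕` with continuous paths and `W₀ = 0`; if along a set
`T` unbounded above or below every stopped harmonic observable `N^{x,m}` is an `𝓕`-martingale, then
for every `L > 0` the stopped driver `W^{ρ_L}`, `ρ_L = Loewner.farStopTime W L`, is an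
`𝓕`-martingale. -/
def HarmonicStoppedDriver : Prop :=
  ∀ {Ω : Type} [MeasurableSpace Ω] (P : Measure Ω) [IsProbabilityMeasure P] (W : ℝ≥0 → Ω → ℝ)
    (𝓕 : Filtration ℝ≥0 ‹MeasurableSpace Ω›), StronglyAdapted 𝓕 W → (∀ ω, Continuous (W · ω)) →
    (∀ ω, W 0 ω = 0) → ∀ T : Set ℝ, ¬ (BddAbove T ∧ BddBelow T) →
    (∀ x ∈ T, ∀ m : ℕ, Martingale (harmonicProcess W x m) 𝓕 P) →
      ∀ L : ℝ, 0 < L → Martingale (stoppedProcess W (Loewner.farStopTime W L)) 𝓕 P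

/-- STUB C statement — **far field, order `x⁻²`: `(W^{ρ_L})² − (8/3)(· ∧ ρ_L)` is a martingale.**
Same hypotheses; the coefficient `b(2b+1) = 45/32` of `x^{5/4} N^x` at `b = 5/8` forces the
compensator `6t/(2b+1) = (8/3) t`. -/
def HarmonicStoppedQuad : Prop :=
  ∀ {Ω : Type} [MeasurableSpace Ω] (P : Measure Ω) [IsProbabilityMeasure P] (W : ℝ≥0 → Ω → ℝ)
    (𝓕 : Filtration ℝ≥0 ‹MeasurableSpace Ω›), StronglyAdapted 𝓕 W → (∀ ω, Continuous (W · ω)) →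
    (∀ ω, W 0 ω = 0) → ∀ T : Set ℝ, ¬ (BddAbove T ∧ BddBelow T) →
    (∀ x ∈ T, ∀ m : ℕ, Martingale (harmonicProcess W x m) 𝓕 P) →
      ∀ L : ℝ, 0 < L → Martingale (fun r ω ↦ stoppedProcess W (Loewner.farStopTime W L) r ω ^ 2 -
        (8 / 3 : ℝ) * (((min (r : WithTop ℝ≥0) (Loewner.farStopTime W L ω)).untopA : ℝ≥0) : ℝ)) 𝓕 P

/-! ### 3. Path dependence of the stopped observable (sorry-free bookkeeping for the composition) -/

/-- Two processes with the same path at `ω` have the same stopped harmonic observables at `ω`. -/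
theorem harmonicProcess_congr {Ω : Type*} {W₁ W₂ : ℝ≥0 → Ω → ℝ} {ω : Ω}
    (h : ∀ u, W₁ u ω = W₂ u ω) (x : ℝ) (m : ℕ) (t : ℝ≥0) :
    harmonicProcess W₁ x m t ω = harmonicProcess W₂ x m t ω := by
  have hp : (fun u ↦ W₁ u ω) = fun u ↦ W₂ u ω := funext h
  simp only [harmonicProcess, hp]

/-! ### 4. The registered stubs (the only `sorry`s of the file) -/

/-- STUB A (M/L): cylinder identities ⇒ natural-filtration martingales. Why plausibly true: the
stopped observable is bounded by `max((m+1)^{5/4}, |x|^{-5/4})` and is a measurable functional of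
the path up to time `t` (tree: `Loewner.measurable_realFlowTrunc`, hitting times of continuous adapted
processes), then `Process.martingale_natural_of_integral_cylinder`; why it might fail: only through a
measurability gap at the level time (progressive measurability of `(t, ω) ↦ N^x_t` across the junk
region) — repaired by restating with the truncated flow. -/
theorem stub_harmonicNaturalMartingales : HarmonicNaturalMartingales := by
  sorry

/-- STUB B (L): far field, order `x⁻¹` ⇒ `W^{ρ_L}` martingale. Why plausibly true: the tree's
`Loewner.FarRegime` expansion (`norm_g_sub_expansion_le`, `norm_deriv_map_sub_le`,
`norm_exponent_sub_le`, LoewnerFarField.lean) at the real point `x`, `|x| ≥ L`, and the coefficient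
lemma `Loewner.integral_abs_condExp_stoppedDriver_sub_le_of_coeff`, verbatim the spin proof; why it
might fail: the observable level time `τ^{x,m}` must not bite before `ρ_L` (take `m + 1 ≥ (L/128)²`
and `|x| ≥ L`), else optional stopping loses the identity. -/
theorem stub_harmonicStoppedDriver : HarmonicStoppedDriver := by
  sorry

/-- STUB C (L, hardest): far field, order `x⁻²` ⇒ `(W^{ρ_L})² − (8/3)(· ∧ ρ_L)` martingale
(`Loewner.integral_abs_condExp_stoppedQuad_sub_le_of_coeff` with the rescaled martingale
`1 + (32/45) x² (|x|^{5/4} N^{x,m} − 1 − (5/4) W/x)`); why it might fail: only through a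
mis-normalised observable — the second-order coefficient `b(2b+1)` and hence `κ = 6/(2b+1)` is an
identity of the expansion. -/
theorem stub_harmonicStoppedQuad : HarmonicStoppedQuad := by
  sorry

/-! ### Name-keyed aliases of the stub statements (hypotheses of the composition)

The skeleton audit (`#h21_check_skeleton`) admits a hypothesis of the skeleton theorem only if its head
constant is a registered obligation or is NAMED like a declared stub; `__Registered.stub_X : Prop` is the
statement of `stub_X` under that name (device of `Cruxes/AxiomsOfLimit/Lines/birth.lean`,
`Cruxes/EventualTight/Lines/birth.lean`: the `__` namespace is an implementation detail, so the audit's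
stub report resolves each `stub_…` to the sorried theorem, not to the alias; the gate-reserved `@[stub]`
attribute is not written by a planner). Each alias is `rfl`-equal to its statement. -/
namespace __Registered

/-- Alias keyed by the registered stub name. -/
abbrev stub_harmonicNaturalMartingales : Prop := HarmonicNaturalMartingales
/-- Alias keyed by the registered stub name. -/
abbrev stub_harmonicStoppedDriver : Prop := HarmonicStoppedDriver
/-- Alias keyed by the registered stub name. -/
abbrev stub_harmonicStoppedQuad : Prop := HarmonicStoppedQuad

end __Registered

/-! ### 5. The composition (kernel-checked, no `sorry`) -/

/-- **The three stubs imply the crux `HarmonicIdentification` BY NAME.** -/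
theorem HarmonicIdentification_of (hA : __Registered.stub_harmonicNaturalMartingales)
    (hB : __Registered.stub_harmonicStoppedDriver) (hC : __Registered.stub_harmonicStoppedQuad) :
    Summit.CriticalPhenomena.SAWScalingLimit.Theses.SAWLaplacianWalk.HarmonicIdentification := by
  intro D φ ν T W gap N τ hφ hν hdesc hT hcyl
  haveI : IsProbabilityMeasure ν := hν
  have hdesc' : ∀ᵐ c ∂ν, IsLoewnerDescribable φ c := hdesc.mono fun c hc ↦ hc.1
  have hsrc : ∀ᵐ c ∂ν, c.source = D.pt 0 := hdesc.mono fun c hc ↦ hc.2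
  -- (1) the Loewner transform `V = drivingFunction φ` and its recentred version `V′ = V − V₀`
  set V : CurveClass ℂ → ℝ≥0 → ℝ := drivingFunction φ with hVdef
  set V' : CurveClass ℂ → ℝ≥0 → ℝ := fun c t ↦ V c t - V c 0 with hV'
  have hae0 : ∀ᵐ c ∂ν, V c 0 = 0 := ae_drivingFunction_apply_zero hφ hsrc
  have haeV : ∀ᵐ c ∂ν, V' c = V c := by
    filter_upwards [hae0] with c hc
    funext t
    simp [hV', hc]
  have hV'm : ∀ t, StronglyMeasurable (fun c ↦ V' c t) := fun t ↦
    (stronglyMeasurable_drivingFunction_apply hφ t).sub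
      (stronglyMeasurable_drivingFunction_apply hφ 0)
  have hV'c : ∀ c, Continuous (V' c) := fun c ↦
    (continuous_drivingFunction φ c).sub continuous_const
  have hV'0 : ∀ c, V' c 0 = 0 := fun c ↦ by simp [hV']
  -- (2) the crux hypothesis is the harmonic cylinder identity of `V` along `T` (definitional)
  have hcylV : HarmonicCylinderIdentity ν (fun t c ↦ V c t) T := by
    intro x hx m s t hst n S hS ψ hψc hψb
    exact hcyl x hx m s t hst n S hS ψ hψc hψb
  -- … and transfers to `V′` (a.e. equal paths; the observables read the path only)
  have hcylV' : HarmonicCylinderIdentity ν (fun t c ↦ V' c t) T := by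
    intro x hx m s t hst n S hS ψ hψc hψb
    rw [← hcylV x hx m s t hst n S hS ψ hψc hψb]
    refine integral_congr_ae ?_
    filter_upwards [haeV] with c hcV
    have hpath : ∀ u, (fun t c ↦ V' c t) u c = (fun t c ↦ V c t) u c := fun u ↦ congrFun hcV u
    simp only [harmonicProcess_congr (W₁ := fun t c ↦ V' c t) (W₂ := fun t c ↦ V c t) (ω := c)
      hpath, hcV]
  -- (3) natural martingales [stub A], the two stopped martingales at every level [stubs B, C]
  have hVad : StronglyAdapted (Filtration.natural (fun t c ↦ V' c t) hV'm) (fun t c ↦ V' c t) :=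
    Filtration.stronglyAdapted_natural hV'm
  have hmart : ∀ x ∈ T, ∀ m : ℕ,
      Martingale (harmonicProcess (fun t c ↦ V' c t) x m) (Filtration.natural (fun t c ↦ V' c t) hV'm) ν :=
    hA ν (fun t c ↦ V' c t) hV'm (fun c ↦ hV'c c) (fun c ↦ hV'0 c) T hcylV'
  have hdrv : ∀ L : ℝ, 0 < L → Martingale (stoppedProcess (fun t c ↦ V' c t)
      (Loewner.farStopTime (fun t c ↦ V' c t) L)) (Filtration.natural (fun t c ↦ V' c t) hV'm) ν :=
    hB ν (fun t c ↦ V' c t) _ hVad (fun c ↦ hV'c c) (fun c ↦ hV'0 c) T hT hmart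
  have hquad : ∀ L : ℝ, 0 < L → Martingale (fun r c ↦ stoppedProcess (fun t c ↦ V' c t)
      (Loewner.farStopTime (fun t c ↦ V' c t) L) r c ^ 2 -
        (8 / 3 : ℝ) * (((min (r : WithTop ℝ≥0) (Loewner.farStopTime (fun t c ↦ V' c t) L c)).untopA
          : ℝ≥0) : ℝ)) (Filtration.natural (fun t c ↦ V' c t) hV'm) ν :=
    hC ν (fun t c ↦ V' c t) _ hVad (fun c ↦ hV'c c) (fun c ↦ hV'0 c) T hT hmart
  -- (4) localisation along `ρ_{n+1}`: `V′/√(8/3)` is a continuous local martingale with `⟨·⟩_t = t`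
  have hloc := Loewner.isLocalizingSequence_farStopTime (P := ν) hVad (fun c ↦ hV'c c)
  have hLn : ∀ n : ℕ, (0 : ℝ) < n + 1 := fun n ↦ by positivity
  have h1 : IsLocalMartingale (fun t c ↦ (Real.sqrt (8 / 3))⁻¹ * V' c t)
      (Filtration.natural (fun t c ↦ V' c t) hV'm) ν := by
    refine ⟨_, hloc, fun n ↦ ?_⟩
    rw [Loewner.indicator_bot_lt_farStopTime (fun c ↦ hV'c c) (fun c ↦ hV'0 c) (hLn n)]
    have h := (hdrv _ (hLn n)).smul (Real.sqrt (8 / 3))⁻¹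
    have heq : stoppedProcess (fun t c ↦ (Real.sqrt (8 / 3))⁻¹ * V' c t)
        (Loewner.farStopTime (fun t c ↦ V' c t) ((n : ℝ) + 1)) =
        (Real.sqrt (8 / 3))⁻¹ • stoppedProcess (fun t c ↦ V' c t)
          (Loewner.farStopTime (fun t c ↦ V' c t) ((n : ℝ) + 1)) := by
      funext r c
      simp only [stoppedProcess, Pi.smul_apply, smul_eq_mul]
    rw [heq]
    exact h
  have h2 : IsLocalMartingale (fun t c ↦ ((Real.sqrt (8 / 3))⁻¹ * V' c t) ^ 2 - (t : ℝ))
      (Filtration.natural (fun t c ↦ V' c t) hV'm) ν := by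
    refine ⟨_, hloc, fun n ↦ ?_⟩
    rw [Loewner.indicator_bot_lt_farStopTime (fun c ↦ hV'c c) (fun c ↦ hV'0 c) (hLn n)]
    have h := (hquad _ (hLn n)).smul (8 / 3 : ℝ)⁻¹
    have heq : stoppedProcess (fun t c ↦ ((Real.sqrt (8 / 3))⁻¹ * V' c t) ^ 2 - (t : ℝ))
          (Loewner.farStopTime (fun t c ↦ V' c t) ((n : ℝ) + 1)) =
        (8 / 3 : ℝ)⁻¹ • fun r c ↦ stoppedProcess (fun t c ↦ V' c t)
          (Loewner.farStopTime (fun t c ↦ V' c t) ((n : ℝ) + 1)) r c ^ 2 -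
          (8 / 3 : ℝ) * (((min (r : WithTop ℝ≥0)
            (Loewner.farStopTime (fun t c ↦ V' c t) ((n : ℝ) + 1) c)).untopA : ℝ≥0) : ℝ) := by
      funext r c
      simp only [stoppedProcess, Pi.smul_apply, smul_eq_mul]
      rw [mul_pow, inv_pow, Real.sq_sqrt (by norm_num : (0 : ℝ) ≤ 8 / 3)]
      ring
    rw [heq]
    exact h
  have hQ : HasQuadraticVariation (fun t c ↦ (Real.sqrt (8 / 3))⁻¹ * V' c t) (fun t _ ↦ (t : ℝ))
      (Filtration.natural (fun t c ↦ V' c t) hV'm) ν :=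
    { adapted := fun _ ↦ measurable_const
      continuous := ae_of_all _ fun _ ↦ NNReal.continuous_coe
      monotone := ae_of_all _ fun _ _ _ h ↦ NNReal.coe_le_coe.2 h
      zero := fun _ ↦ NNReal.coe_zero
      isLocalMartingale := h2 }
  -- (5) Lévy + the SLE_{8/3} trace and its transience (`κ = 8/3 < 4`): theorems of the tree
  have hsq : Real.sqrt ((((8 : ℝ≥0) / 3 : ℝ≥0)) : ℝ) = Real.sqrt (8 / 3) := by
    rw [NNReal.coe_div]
    norm_num
  have hκ0 : (0 : ℝ≥0) < (8 : ℝ≥0) / 3 := by positivity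
  have hκ4 : (8 : ℝ≥0) / 3 < 4 := by
    rw [div_lt_iff₀ (by norm_num : (0 : ℝ≥0) < 3)]
    norm_num
  refine isSLELaw_of_isLocalMartingale_driving_of_lt_four hκ0 hκ4 hφ (W := V')
    (fun t ↦ (hV'm t).measurable) (ae_of_all _ hV'0) (ae_of_all _ hV'c)
    (𝓕 := Filtration.natural (fun t c ↦ V' c t) hV'm) ?_ ?_ ?_
  · simpa only [hsq] using h1
  · simpa only [hsq] using hQ
  · filter_upwards [hdesc', haeV] with c hc hcV
    rw [hcV]
    obtain ⟨-, γ, hγ, c', hc', hI⟩ := isLoewnerDescribed_drivingFunction hc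
    exact ⟨γ, hγ, c', hc', hI⟩

/-- Wiring check: the registered stubs feed `HarmonicIdentification_of` as stated. -/
example : Summit.CriticalPhenomena.SAWScalingLimit.Theses.SAWLaplacianWalk.HarmonicIdentification :=
  HarmonicIdentification_of stub_harmonicNaturalMartingales stub_harmonicStoppedDriver
    stub_harmonicStoppedQuad

end Summit.CriticalPhenomena.SAWScalingLimit.Cruxes.HarmonicIdentification.Birth

end
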